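import Literature.AlgebraicGeometry.Resolution.AbhyankarToroidalCharts
import Mathlib.FieldTheory.IsAlgClosed.AlgebraicClosure
import Mathlib.FieldTheory.PurelyInseparable.Basic
import Mathlib.RingTheory.IntegralClosure.IntegrallyClosed
import HarnessLib

/-!
# Thm. 5.5.3 of Temkin 2013 in compositum form (the constant extension `L = lK`)

Topic: `Literature/AlgebraicGeometry/Resolution`. A PROVED bridge between two renderings of
M. Temkin, *Inseparable local uniformization*, J. Algebra 373 (2013) 65–119 = arXiv:0804.1554v3,
Thm. 5.5.3 (p. 61; residual separability of a finitely generated Abhyankar valued field after a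
finite purely inseparable extension of the constants): the named fact `Temkin2013_Thm553` of
`AbhyankarToroidalCharts.lean` speaks of an abstract extension `l/k` and of every compositum
`K' = l'K` for `l' ⊇ l`; the descent files (`InseparableLocalUniformizationAbhyankarReduction.lean`,
fact `Temkin2013ResidueSeparable`, and the first paragraph of the proof of Thm. 5.5.2) consume
ONE compositum `L = lK ⊇ K`, finite purely inseparable over `K`, with `l` an intermediate field
of `L/k`. `exists_compositum_of_thm553` constructs that compositum inside an algebraic closure of
`K` and transports the separability statement to it, so that `Temkin2013_Thm553` implies the
compositum form (and hence `Temkin2013ResidueSeparable`).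

## Source

* M. Temkin, *Inseparable local uniformization*, arXiv:0804.1554v3: Thm. 5.5.3 (p. 61) and the
  first paragraph of the proof of Thm. 5.5.2 (p. 60).
-/

noncomputable section

namespace Literature.AlgebraicGeometry.Resolution

open IsLocalRing ValuationSubring

universe u

/-- **Thm. 5.5.3 in compositum form** (Temkin 2013, Thm. 5.5.3, p. 61: "If `K` is a finitely
generated Abhyankar valued field over `k` then there exists a finite purely inseparable
extension `l/k` such that for any finite purely inseparable extension `l'/l` the field `l'K~`
is separable over `l'`"; first paragraph of the proof of Thm. 5.5.2, p. 60: "there exists a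
finite purely inseparable extension `l/k` such that all fields `lKᵢ~` are separable over `l`
… `L = lK`"). From the tree's rendering `Temkin2013_Thm553` (`AbhyankarToroidalCharts.lean`:
an abstract `l` and the separability statement for every compositum `l'K`, `l' ⊇ l`) we
derive, for `l' = l`, the form consumed by the descent files: a finite purely inseparable
extension `L/K` with an intermediate field `l` of `L/k`, finite and purely inseparable over
`k`, such that `K[l] = L`, and for every valuation ring `L°` of `L` over `K°`: `l ⊆ L°` and the
residue field `L̃` has a finite separating transcendence basis over `l`. PROVED: `L := K(l)`
inside an algebraic closure `Ω` of `K` (`l → Ω` by `IsAlgClosed.lift`; `L` is generated by the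
image of a `k`-basis of `l`, hence finite over `K`, and purely inseparable as `l/k` is), `l` is
identified with its image `l̄ ≤ L` (`AlgEquiv.ofInjectiveField`), `l̄ ⊆ L°` because `L°` is
integrally closed and contains `k`, and `Temkin2013_Thm553` is applied with `l' := l̄`,
`K' := L`. [cite: Temkin2013, Thm. 5.5.3 (p. 61 of arXiv:0804.1554v3)] -/
theorem exists_compositum_of_thm553 (h : Temkin2013_Thm553.{u}) (k K : Type u) [Field k]
    [Field K] [Algebra k K] (hfg : (⊤ : IntermediateField k K).FG) (O : ValuationSubring K)
    (hk : ∀ c : k, algebraMap k K c ∈ O) (hD : transcendenceDefect k O hk = 0) :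
    ∃ (L : Type u) (_ : Field L) (_ : Algebra K L) (_ : Algebra k L) (_ : IsScalarTower k K L),
      FiniteDimensional K L ∧ IsPurelyInseparable K L ∧
      ∃ l : IntermediateField k L, FiniteDimensional k l ∧ IsPurelyInseparable k l ∧
        Algebra.adjoin K (l : Set L) = ⊤ ∧
        ∀ O_L : ValuationSubring L, O_L.comap (algebraMap K L) = O →
          ∃ hl : (∀ c : l, algebraMap l L c ∈ O_L),
            letI := algebraOfMem l O_L hl
            ∃ s : Finset (ResidueField O_L),
              AlgebraicIndependent l ((↑) : s → ResidueField O_L) ∧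
              Algebra.IsSeparable (IntermediateField.adjoin l (s : Set (ResidueField O_L)))
                (ResidueField O_L) := by
  classical
  obtain ⟨l, _, _, hlfin, hlpi, H⟩ := h k K hfg O hk hD
  haveI := hlfin
  haveI := hlpi
  -- the compositum `lK` inside an algebraic closure of `K`
  let Ω : Type u := AlgebraicClosure K
  let φ : l →ₐ[k] Ω := IsAlgClosed.lift
  let bl := Module.finBasis k l
  let S : Set Ω := Set.range (φ ∘ bl)
  have hSfin : S.Finite := Set.finite_range _
  have hSint : ∀ x ∈ S, IsIntegral K x := by
    rintro _ ⟨i, rfl⟩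
    have h1 : IsIntegral k (bl i) := Algebra.IsIntegral.isIntegral (bl i)
    exact (h1.map φ).tower_top
  let Lf : IntermediateField K Ω := IntermediateField.adjoin K S
  haveI : FiniteDimensional K Lf := IntermediateField.finiteDimensional_adjoin hSint
  -- `L = K(l)` is purely inseparable over `K`
  obtain ⟨q, hq⟩ := ExpChar.exists k
  haveI : ExpChar K q := expChar_of_injective_algebraMap (algebraMap k K).injective q
  haveI hLpi : IsPurelyInseparable K Lf := by
    rw [IntermediateField.isPurelyInseparable_adjoin_iff_pow_mem K Ω q]
    rintro _ ⟨i, rfl⟩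
    obtain ⟨n, y, hy⟩ := IsPurelyInseparable.pow_mem k q (bl i)
    refine ⟨n, algebraMap k K y, ?_⟩
    show algebraMap K Ω (algebraMap k K y) = (φ (bl i)) ^ q ^ n
    rw [← IsScalarTower.algebraMap_apply k K Ω, ← map_pow, ← hy, AlgHom.commutes]
  -- the copy `l̄` of `l` inside `L`
  have hrange : ∀ a : l, φ a ∈ Lf := by
    intro a
    have ha : a ∈ Submodule.span k (Set.range bl) := by rw [bl.span_eq]; trivial
    refine Submodule.span_induction ?_ ?_ ?_ ?_ ha
    · rintro _ ⟨i, rfl⟩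
      exact IntermediateField.subset_adjoin K S ⟨i, rfl⟩
    · rw [map_zero]; exact zero_mem _
    · intro a b _ _ ha hb
      rw [map_add]; exact add_mem ha hb
    · intro c a _ ha
      rw [map_smul, Algebra.smul_def, IsScalarTower.algebraMap_apply k K Ω]
      exact mul_mem (IntermediateField.algebraMap_mem Lf _) ha
  let ψ : l →ₐ[k] Lf :=
    { toFun := fun a => ⟨φ a, hrange a⟩
      map_one' := Subtype.ext (map_one φ)
      map_mul' := fun a b => Subtype.ext (map_mul φ a b)
      map_zero' := Subtype.ext (map_zero φ)
      map_add' := fun a b => Subtype.ext (map_add φ a b)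
      commutes' := fun c => Subtype.ext (by
        show φ (algebraMap k l c) = ((algebraMap k Lf c : Lf) : Ω)
        rw [AlgHom.commutes, IsScalarTower.algebraMap_apply k K Ω c]
        rfl) }
  have hψ : ∀ a : l, ((ψ a : Lf) : Ω) = φ a := fun _ => rfl
  let lb : IntermediateField k Lf := ψ.fieldRange
  have hlb_mem : ∀ a : l, ψ a ∈ lb := fun a => ⟨a, rfl⟩
  let e : l ≃ₐ[k] lb := AlgEquiv.ofInjectiveField ψ
  haveI : FiniteDimensional k lb := LinearEquiv.finiteDimensional e.toLinearEquiv
  haveI : IsPurelyInseparable k lb := AlgEquiv.isPurelyInseparable e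
  -- `K[l̄] = L`
  have hadj : Algebra.adjoin K (lb : Set Lf) = ⊤ := by
    refine eq_top_iff.mpr fun w _ => ?_
    have hw : (w : Ω) ∈ (IntermediateField.adjoin K S).toSubalgebra := w.2
    rw [IntermediateField.adjoin_toSubalgebra_of_isAlgebraic
      (fun x hx => (hSint x hx).isAlgebraic)] at hw
    have hmap : (Algebra.adjoin K (lb : Set Lf)).map (IntermediateField.val Lf) =
        Algebra.adjoin K ((IntermediateField.val Lf) '' (lb : Set Lf)) := AlgHom.map_adjoin _ _
    have hSsub : S ⊆ (IntermediateField.val Lf) '' (lb : Set Lf) := by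
      rintro _ ⟨i, rfl⟩
      exact ⟨ψ (bl i), hlb_mem _, rfl⟩
    have hw' : (w : Ω) ∈ (Algebra.adjoin K (lb : Set Lf)).map (IntermediateField.val Lf) := by
      rw [hmap]
      exact Algebra.adjoin_mono hSsub hw
    obtain ⟨w', hw', hww'⟩ := Subalgebra.mem_map.mp hw'
    have : w' = w := Subtype.ext hww'
    rwa [← this]
  refine ⟨Lf, inferInstance, inferInstance, inferInstance, inferInstance, inferInstance, hLpi,
    lb, inferInstance, inferInstance, hadj, fun O_L hO_L => ?_⟩
  -- `l̄ ⊆ L°`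
  have hkL : ∀ c : k, algebraMap k Lf c ∈ O_L := fun c => by
    have h1 : algebraMap k K c ∈ O_L.comap (algebraMap K Lf) := by rw [hO_L]; exact hk c
    rw [ValuationSubring.mem_comap, ← IsScalarTower.algebraMap_apply] at h1
    exact h1
  have hl : ∀ c : lb, algebraMap lb Lf c ∈ O_L := by
    intro c
    letI : Algebra k O_L := algebraOfMem k O_L hkL
    haveI : IsScalarTower k O_L Lf := isScalarTower_algebraOfMem k O_L hkL
    have hc : IsIntegral k (c : Lf) := (Algebra.IsIntegral.isIntegral (R := k) c).map
      (IsScalarTower.toAlgHom k lb Lf)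
    have hc' : IsIntegral O_L (c : Lf) := hc.tower_top
    obtain ⟨y, hy⟩ := IsIntegrallyClosed.algebraMap_eq_of_integral hc'
    show (c : Lf) ∈ O_L
    rw [← hy]
    exact y.2
  refine ⟨hl, ?_⟩
  -- Thm. 5.5.3 applied with `l' = l̄`, `K' = L`
  letI : Algebra l lb := (e : l →+* lb).toAlgebra
  haveI : IsScalarTower k l lb := IsScalarTower.of_algebraMap_eq fun c =>
    (e.commutes c).symm
  have hgen : Algebra.adjoin K (Set.range (algebraMap lb Lf)) = ⊤ := by
    have : Set.range (algebraMap lb Lf) = (lb : Set Lf) := by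
      ext w
      exact ⟨fun ⟨c, hc⟩ => hc ▸ c.2, fun hw => ⟨⟨w, hw⟩, rfl⟩⟩
    rw [this, hadj]
  obtain ⟨s, hs, hsep⟩ := H lb inferInstance inferInstance Lf hgen O_L hO_L hl
  exact ⟨s, hs.1, ⟨hsep⟩⟩

end Literature.AlgebraicGeometry.Resolution

end
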